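import Literature.Analysis.FluidPDE.WeakSpatialGradientSum
import Literature.Analysis.FunctionSpaces.SobolevTraceDensityProofs
import HarnessLib

/-!
# Product rule for weak spatial gradients with a smooth time-independent scalar

Analysis/FluidPDE support file (theorems only) on the discharge path of
`Literature.Analysis.FluidPDE.seregin2014_limit_decay` (Seregin 2014, App. B, Lemma B.6): the
multiplicative inequality (B.2.5) for the cut-off field `χ_R v` ("An analogue of (B.2.3) is
available with the form `γ_R ≤ c(∫α_R³)^{1/4}(β_R + ∫α_R + R⁻²∫α)^{3/4}`", PDF p. 153) rests on
`∇(χ_R v) = χ_R ∇v + v ⊗ ∇χ_R`. For the tree's weak objects this is the **Leibniz rule for weak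
spatial gradients** (Evans, *PDE*, §5.2.3, Thm. 1 (iv), `D(ζu) = ζDu + uDζ`; the slice-wise rule
is the tree's `FunctionSpaces.hasWeakFDerivOn_smul`, Adams 1975 ¶1.58):

* `HasWeakSpatialGradientOn.smul_left` — if `G` is a weak spatial gradient of `u` on `Q` and
  `ζ : E → ℝ` is smooth, then `(t,x) ↦ ζ(x) G(t,x) + Dζ(x) ⊗ u(t,x)`
  (`v ↦ ζ x • G t x v + (Dζ x v) • u t x`) is a weak spatial gradient of `(t,x) ↦ ζ(x) u(t,x)`
  (test the defining identity with `ζ φ`, again a space–time test function on `Q`).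

## References

* L. C. Evans, *Partial Differential Equations*, 2nd ed., §5.2.3 Thm. 1 (iv). [Evans2010]
* R. A. Adams, *Sobolev Spaces* (1975), ¶1.58. [Adams1975]
* G. Seregin, *Lecture Notes on Regularity Theory for the Navier–Stokes Equations* (2014),
  App. B, proof of Lemma B.6, (B.2.5). [Seregin2014]
-/

noncomputable section

open MeasureTheory Set Function Filter Topology TopologicalSpace Metric Module
open scoped NNReal ENNReal InnerProductSpace RealInnerProductSpace

namespace Literature.Analysis.FluidPDE

variable {E : Type*} [NormedAddCommGroup E] [InnerProductSpace ℝ E] [FiniteDimensional ℝ E]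
  [MeasurableSpace E] [BorelSpace E]

/-- Local integrability of `(t,x) ↦ Dζ(x) ⊗ u(t,x)` on `Q` for smooth `ζ` and locally
integrable `u` (continuous bounded first factor on compacts). [folklore] -/
theorem locallyIntegrableOn_fderiv_smulRight_uncurry {Q : Opens (ℝ × E)} {u : ℝ → E → E}
    (hu : LocallyIntegrableOn (uncurry u) (Q : Set (ℝ × E)) volume) {ζ : E → ℝ}
    (hζ : ContDiff ℝ (⊤ : ℕ∞) ζ) :
    LocallyIntegrableOn (fun z : ℝ × E => (fderiv ℝ ζ z.2).smulRight (u z.1 z.2))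
      (Q : Set (ℝ × E)) volume := by
  refine locallyIntegrableOn_opens_iff.2 fun K hK hKc => ?_
  have huK : IntegrableOn (uncurry u) K volume := locallyIntegrableOn_opens_iff.1 hu K hK hKc
  have hcont : Continuous fun z : ℝ × E => fderiv ℝ ζ z.2 :=
    (hζ.continuous_fderiv (by simp)).comp continuous_snd
  obtain ⟨M, hM⟩ := hKc.exists_bound_of_continuousOn hcont.continuousOn
  have hmeas : AEStronglyMeasurable (fun z : ℝ × E => (fderiv ℝ ζ z.2).smulRight (u z.1 z.2))
      (volume.restrict K) :=
    (ContinuousLinearMap.smulRightL ℝ E E).continuous₂.comp_aestronglyMeasurable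
      (hcont.aestronglyMeasurable.prodMk huK.aestronglyMeasurable)
  refine Integrable.mono' (huK.norm.const_mul (max M 0)) hmeas ?_
  filter_upwards [ae_restrict_mem hKc.measurableSet] with z hz
  rw [ContinuousLinearMap.norm_smulRight_apply]
  calc ‖fderiv ℝ ζ z.2‖ * ‖u z.1 z.2‖ ≤ max M 0 * ‖uncurry u z‖ :=
        mul_le_mul_of_nonneg_right ((hM z hz).trans (le_max_left _ _)) (norm_nonneg _)
    _ = max M 0 * ‖uncurry u z‖ := rfl

/-- **Leibniz rule for weak spatial gradients.** If `G` is a weak spatial gradient of `u` on the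
open space–time region `Q` and `ζ : E → ℝ` is smooth (time-independent), then
`(t,x) ↦ ζ(x) G(t,x) + Dζ(x) ⊗ u(t,x)` is a weak spatial gradient of `(t,x) ↦ ζ(x) u(t,x)` on `Q`
(Evans, *PDE*, §5.2.3, Thm. 1 (iv); proof: the defining identity for `u` tested with the
space–time test function `ζ φ`, and `∂ᵥ(ζφ) = (∂ᵥζ)φ + ζ∂ᵥφ`). A dot-notation extension of the
accepted structure. [cite: Evans2010, §5.2.3 Thm. 1 (iv)] -/
theorem HasWeakSpatialGradientOn.smul_left {Q : Opens (ℝ × E)} {u : ℝ → E → E}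
    {G : ℝ → E → E →L[ℝ] E} (h : HasWeakSpatialGradientOn Q u G) {ζ : E → ℝ}
    (hζ : ContDiff ℝ (⊤ : ℕ∞) ζ) :
    HasWeakSpatialGradientOn Q (fun t x => ζ x • u t x)
      (fun t x => ζ x • G t x + (fderiv ℝ ζ x).smulRight (u t x)) where
  locallyIntegrableOn := by
    have e : uncurry (fun t x => ζ x • u t x) = fun z : ℝ × E => ζ z.2 • uncurry u z := rfl
    rw [e]
    exact h.locallyIntegrableOn.continuousOn_smul Q.isOpen.isLocallyClosed
      (hζ.continuous.comp continuous_snd).continuousOn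
  locallyIntegrableOn_grad := by
    have e : uncurry (fun t x => ζ x • G t x + (fderiv ℝ ζ x).smulRight (u t x)) =
        fun z : ℝ × E => ζ z.2 • uncurry G z + (fderiv ℝ ζ z.2).smulRight (u z.1 z.2) := rfl
    rw [e]
    exact LocallyIntegrableOn.add (ε'' := E →L[ℝ] E)
      (LocallyIntegrableOn.continuousOn_smul (E := E →L[ℝ] E) Q.isOpen.isLocallyClosed
        h.locallyIntegrableOn_grad (hζ.continuous.comp continuous_snd).continuousOn)
      (locallyIntegrableOn_fderiv_smulRight_uncurry h.locallyIntegrableOn hζ)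
  integral_fderiv_mul_inner_eq φ hφ v w := by
    -- the test function `ζ φ`
    set ψ : ℝ → E → ℝ := fun t x => ζ x * φ t x with hψ
    have hψtest : IsSpaceTimeTestOn Q ψ :=
      FunctionSpaces.SobolevApprox.isTestFunctionOn_mul_left hφ (hζ.comp contDiff_snd)
    -- compact support data
    set K := tsupport (uncurry φ) with hK
    have hKc : IsCompact K := hφ.hasCompactSupport
    have hKQ : K ⊆ (Q : Set (ℝ × E)) := hφ.tsupport_subset
    have hφK : ∀ z ∉ K, φ z.1 z.2 = 0 := fun z hz =>
      show uncurry φ z = 0 from image_eq_zero_of_notMem_tsupport hz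
    have hdφK : ∀ z ∉ K, fderiv ℝ (φ z.1) z.2 v = 0 := fun z hz => by
      rw [IsSpaceTimeTestOn.fderiv_slice_eq_zero_of_notMem hz]; rfl
    -- continuity of the coefficient functions
    have hcφ : Continuous fun z : ℝ × E => φ z.1 z.2 := hφ.contDiff.continuous
    have hcdφ : Continuous fun z : ℝ × E => fderiv ℝ (φ z.1) z.2 v :=
      ((hφ.mono le_top).fderiv_apply_top v).contDiff.continuous
    have hcζ : Continuous fun z : ℝ × E => ζ z.2 := hζ.continuous.comp continuous_snd
    have hcdζ : Continuous fun z : ℝ × E => fderiv ℝ ζ z.2 v :=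
      ((hζ.continuous_fderiv (by simp)).clm_apply continuous_const).comp continuous_snd
    -- the slice derivative of `ψ`
    have hdψ : ∀ t x, fderiv ℝ (ψ t) x v = fderiv ℝ ζ x v * φ t x + ζ x * fderiv ℝ (φ t) x v := by
      intro t x
      have hdζ : DifferentiableAt ℝ ζ x := (hζ.differentiable (by simp)) x
      have hdφ : DifferentiableAt ℝ (φ t) x := (hφ.contDiff_slice t).differentiable (by simp) x
      show fderiv ℝ (fun y => ζ y * φ t y) x v = _
      rw [fderiv_fun_mul hdζ hdφ]
      show ζ x * fderiv ℝ (φ t) x v + φ t x * fderiv ℝ ζ x v = _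
      ring
    -- locally integrable inner products
    have hiu : LocallyIntegrableOn (fun z : ℝ × E => ⟪u z.1 z.2, w⟫) (Q : Set (ℝ × E)) volume := by
      refine locallyIntegrableOn_opens_iff.2 fun K' hK' hK'c => ?_
      exact (locallyIntegrableOn_opens_iff.1 h.locallyIntegrableOn K' hK' hK'c).inner_const (𝕜 := ℝ) w
    have hiG : LocallyIntegrableOn (fun z : ℝ × E => ⟪G z.1 z.2 v, w⟫) (Q : Set (ℝ × E)) volume := by
      refine locallyIntegrableOn_opens_iff.2 fun K' hK' hK'c => ?_
      exact ((ContinuousLinearMap.apply ℝ E v).integrable_comp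
        (locallyIntegrableOn_opens_iff.1 h.locallyIntegrableOn_grad K' hK' hK'c)).inner_const (𝕜 := ℝ) w
    -- the integrable products
    have I₁ : Integrable (fun z : ℝ × E => (fderiv ℝ ζ z.2 v * φ z.1 z.2) * ⟪u z.1 z.2, w⟫) volume := by
      refine (integrable_mul_of_locallyIntegrableOn hiu (hcdζ.mul hcφ) hKc hKQ fun z hz => ?_).congr
        (Eventually.of_forall fun z => ?_)
      · show fderiv ℝ ζ z.2 v * φ z.1 z.2 = 0
        rw [hφK z hz, mul_zero]
      · show ⟪u z.1 z.2, w⟫ * (fderiv ℝ ζ z.2 v * φ z.1 z.2) = _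
        ring
    have I₂ : Integrable (fun z : ℝ × E => (ζ z.2 * fderiv ℝ (φ z.1) z.2 v) * ⟪u z.1 z.2, w⟫) volume := by
      refine (integrable_mul_of_locallyIntegrableOn hiu (hcζ.mul hcdφ) hKc hKQ fun z hz => ?_).congr
        (Eventually.of_forall fun z => ?_)
      · show ζ z.2 * fderiv ℝ (φ z.1) z.2 v = 0
        rw [hdφK z hz, mul_zero]
      · show ⟪u z.1 z.2, w⟫ * (ζ z.2 * fderiv ℝ (φ z.1) z.2 v) = _
        ring
    have J₁ : Integrable (fun z : ℝ × E => (ζ z.2 * φ z.1 z.2) * ⟪G z.1 z.2 v, w⟫) volume := by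
      refine (integrable_mul_of_locallyIntegrableOn hiG (hcζ.mul hcφ) hKc hKQ fun z hz => ?_).congr
        (Eventually.of_forall fun z => ?_)
      · show ζ z.2 * φ z.1 z.2 = 0
        rw [hφK z hz, mul_zero]
      · show ⟪G z.1 z.2 v, w⟫ * (ζ z.2 * φ z.1 z.2) = _
        ring
    have J₂ : Integrable (fun z : ℝ × E => (fderiv ℝ ζ z.2 v * φ z.1 z.2) * ⟪u z.1 z.2, w⟫) volume := I₁
    -- the identity for `u` tested with `ψ = ζ φ`
    have key := h.integral_fderiv_mul_inner_eq ψ hψtest v w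
    have lhs : ∫ t, ∫ x, fderiv ℝ (ψ t) x v * ⟪u t x, w⟫ =
        (∫ t, ∫ x, (fderiv ℝ ζ x v * φ t x) * ⟪u t x, w⟫) +
          ∫ t, ∫ x, (ζ x * fderiv ℝ (φ t) x v) * ⟪u t x, w⟫ := by
      rw [← integral_integral_add_prod I₁ I₂]
      refine integral_congr_ae (Eventually.of_forall fun t => integral_congr_ae
        (Eventually.of_forall fun x => ?_))
      show fderiv ℝ (ψ t) x v * ⟪u t x, w⟫ = _
      rw [hdψ t x, add_mul]
    have rhs : ∫ t, ∫ x, ψ t x * ⟪G t x v, w⟫ = ∫ t, ∫ x, (ζ x * φ t x) * ⟪G t x v, w⟫ := rfl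
    rw [lhs, rhs] at key
    -- conclude
    have goal_lhs : ∫ t, ∫ x, fderiv ℝ (φ t) x v * ⟪ζ x • u t x, w⟫ =
        ∫ t, ∫ x, (ζ x * fderiv ℝ (φ t) x v) * ⟪u t x, w⟫ := by
      refine integral_congr_ae (Eventually.of_forall fun t => integral_congr_ae
        (Eventually.of_forall fun x => ?_))
      show fderiv ℝ (φ t) x v * ⟪ζ x • u t x, w⟫ = (ζ x * fderiv ℝ (φ t) x v) * ⟪u t x, w⟫
      rw [real_inner_smul_left]; ring
    have goal_rhs : ∫ t, ∫ x, φ t x * ⟪(ζ x • G t x + (fderiv ℝ ζ x).smulRight (u t x)) v, w⟫ =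
        (∫ t, ∫ x, (ζ x * φ t x) * ⟪G t x v, w⟫) +
          ∫ t, ∫ x, (fderiv ℝ ζ x v * φ t x) * ⟪u t x, w⟫ := by
      rw [← integral_integral_add_prod J₁ J₂]
      refine integral_congr_ae (Eventually.of_forall fun t => integral_congr_ae
        (Eventually.of_forall fun x => ?_))
      show φ t x * ⟪(ζ x • G t x + (fderiv ℝ ζ x).smulRight (u t x)) v, w⟫ =
        (ζ x * φ t x) * ⟪G t x v, w⟫ + (fderiv ℝ ζ x v * φ t x) * ⟪u t x, w⟫
      show φ t x * ⟪ζ x • G t x v + (fderiv ℝ ζ x v) • u t x, w⟫ = _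
      rw [inner_add_left, real_inner_smul_left, real_inner_smul_left]
      ring
    rw [goal_lhs, goal_rhs]
    linarith

end Literature.Analysis.FluidPDE

end
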